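import Literature.AlgebraicGeometry.Morphisms.CechH1FlatBaseChange
import Mathlib.RingTheory.Flat.FaithfullyFlat.Basic
import HarnessLib

/-!
# Faithfully flat descent of Čech `Ȟ¹(𝒰, 𝒪_X)`: `H¹(X ×_A B, 𝒪) = 0 ⇒ H¹(X, 𝒪_X) = 0`
# for `A → B` faithfully flat

Companion of `Morphisms/CechH1FlatBaseChange` (the ascent `H¹(X, 𝒪_X) = 0 ⇒ H¹(X ×_A B, 𝒪) = 0`
for `A → B` flat).  For a cartesian square of schemes over affine bases
```
      Z ──g──▶ X
   f_Z│        │f_X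
      ▼        ▼
   Spec B ──▶ Spec A
```
(`IsPullback g f_Z f_X (Spec (A → B))`), a finite family `𝒰 = (U_i)` of affine opens of the
quasi-separated scheme `X`, and `A → B` flat, the base-change maps
`B ⊗_A Čᵖ(𝒰, 𝒪_X) → Čᵖ(g⁻¹𝒰, 𝒪_Z)` of that file (`bcC0`, `bcC1`, `bcC2`) are bijective in degrees
`0`, `1` and injective in degree `2`, and commute with the differentials.  Consequently
(`lTensor_cechD0_cechD1_exact_of_preimageFamily`) **if every Čech `1`-cocycle of `𝒪_Z` on `g⁻¹𝒰` is
a coboundary, then `B ⊗_A Č⁰(𝒰) → B ⊗_A Č¹(𝒰) → B ⊗_A Č²(𝒰)` is exact**; when `A → B` is moreover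
FAITHFULLY flat, tensoring with `B` reflects exactness (Mathlib
`Module.FaithfullyFlat.lTensor_reflects_exact`), so `Č⁰(𝒰) → Č¹(𝒰) → Č²(𝒰)` is exact, i.e.
`Ȟ¹(𝒰, 𝒪_X) = 0`:

* `cechZ1_le_cechB1_of_preimageFamily_of_faithfullyFlat`,
  `subsingleton_cechH1_of_preimageFamily_of_faithfullyFlat` — **`Ȟ¹(g⁻¹𝒰, 𝒪_Z) = 0 ⇒
  Ȟ¹(𝒰, 𝒪_X) = 0`** (and `subsingleton_cechH1_preimageFamily_iff_of_faithfullyFlat`, both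
  directions together with the flat ascent);
* `subsingleton_cechH1_of_isPullback_of_faithfullyFlat` — **if `Ȟ¹(𝒱, 𝒪_Z) = 0` for every finite
  affine open cover `𝒱` of `Z` then `Ȟ¹(𝒰, 𝒪_X) = 0` for every finite affine open cover `𝒰` of
  the quasi-separated `X`** (pull the cover back: `g` is affine).

This is the Čech form of FAITHFULLY FLAT DESCENT OF THE VANISHING OF COHOMOLOGY,
`H¹(X_B, 𝒪) = H¹(X, 𝒪) ⊗_A B` (The Stacks Project, Tag 02KH) `= 0 ⇒ H¹(X, 𝒪) = 0` for `B`
faithfully flat over `A` — the step "since `B` is faithfully flat over `A`, `H¹(Y_n, 𝒪_{Y_n}) = 0`"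
of J. Lipman, Publ. Math. IHÉS 36 (1969), proof of Prop. (16.5), p. 235 (rational singularities
DESCEND along flat local base change).  Everything is proved; no named facts; no new definitions.
Mathlib searched (pin): `Module.FaithfullyFlat.lTensor_reflects_exact`, `Module.Flat.lTensor_exact`,
`IsAffineOpen.isQuasiSeparated`, `MorphismProperty.of_isPullback` for `@IsAffineHom` (used);
Mathlib has no Čech cohomology of schemes.

## References

* The Stacks Project, Tag 02KH (Cohomology of Schemes, Lemma 30.5.2: flat base change); Tag 00HP
  / 058G (faithfully flat modules reflect exactness); Tag 01ED. [StacksProject]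
* J. Lipman, *Rational singularities, with applications to algebraic surfaces and unique
  factorization*, Publ. Math. IHÉS 36 (1969), Prop. (16.5), proof p. 235. [Lipman1969]
-/

noncomputable section

open CategoryTheory AlgebraicGeometry Limits TopologicalSpace Opposite TensorProduct

universe u v

namespace Literature.AlgebraicGeometry.Morphisms

variable {A B : Type u} [CommRing A] [CommRing B] [Algebra A B] {X Z : Scheme.{u}}
  (fX : X ⟶ Spec (.of A)) (fZ : Z ⟶ Spec (.of B)) (g : Z ⟶ X) {ι : Type v} (U : ι → X.Opens)

/-! ## The comparison in degree `0` -/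

/-- **`B ⊗_A Č⁰(𝒰) → Č⁰(g⁻¹𝒰)` is bijective** (`𝒰` finite with affine members, `A → B` flat):
flat base change of `H⁰` on the affine — hence quasi-compact quasi-separated — opens `U_i`
(`bcPi_bijective`). [cite: StacksProject, Tag 02KH (degree 0)] -/
theorem bcC0_bijective [Finite ι] [Module.Flat A B]
    (H : IsPullback g fZ fX (Spec.map (CommRingCat.ofHom (algebraMap A B))))
    (hU : ∀ i, IsAffineOpen (U i)) : Function.Bijective (bcC0 fX fZ g H.w U) :=
  bcPi_bijective fX fZ g U (preimageFamily g U) (fun _ => le_rfl) H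
    (fun i => (hU i).isCompact) (fun i => (hU i).isQuasiSeparated) (fun _ => le_rfl)

/-! ## Exactness of `B ⊗_A Č•(𝒰)` in degree `1` from `Ȟ¹(g⁻¹𝒰, 𝒪_Z) = 0` -/

/-- **If `Ȟ¹(g⁻¹𝒰, 𝒪_Z) = 0` then `B ⊗_A Č⁰(𝒰) → B ⊗_A Č¹(𝒰) → B ⊗_A Č²(𝒰)` is exact**
(`A → B` flat, `X` quasi-separated, `𝒰` finite with affine members): for `T ∈ B ⊗ Č¹` with
`(1 ⊗ d¹) T = 0`, its image `κ¹(T) ∈ Č¹(g⁻¹𝒰)` is a cocycle (`κ² ∘ (1 ⊗ d¹) = d¹ ∘ κ¹`), hence a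
coboundary `d⁰ S'`, and `S' = κ⁰(S)` (`κ⁰` surjective), so `κ¹(T) = κ¹((1 ⊗ d⁰) S)` and
`T = (1 ⊗ d⁰) S` (`κ¹` injective) — the identification of `B ⊗_A Č•(𝒰, 𝒪_X)` with the Čech
complex of the base change. [cite: StacksProject, Tag 02KH (proof: Čech complex of the base change)] -/
theorem lTensor_cechD0_cechD1_exact_of_preimageFamily [Finite ι] [QuasiSeparatedSpace X]
    [Module.Flat A B] (H : IsPullback g fZ fX (Spec.map (CommRingCat.ofHom (algebraMap A B))))
    (hU : ∀ i, IsAffineOpen (U i))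
    (h : cechZ1 (restrictBase A fZ) (preimageFamily g U) ≤
      cechB1 (restrictBase A fZ) (preimageFamily g U)) :
    Function.Exact (LinearMap.lTensor B (cechD0 fX U)) (LinearMap.lTensor B (cechD1 fX U)) := by
  intro T
  constructor
  · intro hT
    -- `κ¹(T)` is a cocycle on `g⁻¹𝒰`
    have hz : bcC1 fX fZ g H.w U T ∈ cechZ1 (restrictBase A fZ) (preimageFamily g U) := by
      rw [mem_cechZ1_iff, ← bcC2_lTensor_cechD1, hT, map_zero]
    -- hence a coboundary `d⁰ S'`, `S' = κ⁰(S)`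
    obtain ⟨S', hS'⟩ := (mem_cechB1_iff _ _ _).mp (h hz)
    obtain ⟨S, rfl⟩ := (bcC0_bijective fX fZ g U H hU).2 S'
    refine ⟨S, (bcC1_bijective fX fZ g U H hU).1 ?_⟩
    rw [bcC1_lTensor_cechD0, hS']
  · rintro ⟨S, rfl⟩
    rw [← LinearMap.comp_apply, ← LinearMap.lTensor_comp, cechD1_comp_cechD0,
      LinearMap.lTensor_zero, LinearMap.zero_apply]

/-! ## `Ȟ¹(g⁻¹𝒰, 𝒪_Z) = 0 ⇒ Ȟ¹(𝒰, 𝒪_X) = 0` for `A → B` faithfully flat -/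

/-- **Faithfully flat descent of `Ȟ¹ = 0`**: for the cartesian square `Z = X ×_{Spec A} Spec B`
with `A → B` FAITHFULLY flat, `X` quasi-separated and `𝒰` a finite family of affine opens of `X`,
if every Čech `1`-cocycle of `𝒪_Z` on `g⁻¹𝒰` is a coboundary then every Čech `1`-cocycle of `𝒪_X`
on `𝒰` is a coboundary: `B ⊗_A Č•(𝒰)` is exact in degree `1`
(`lTensor_cechD0_cechD1_exact_of_preimageFamily`) and tensoring with the faithfully flat `B`
reflects exactness (`Module.FaithfullyFlat.lTensor_reflects_exact`).
[cite: StacksProject, Tag 02KH (Cohomology of Schemes, Lemma 30.5.2: flat base change)] -/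
theorem cechZ1_le_cechB1_of_preimageFamily_of_faithfullyFlat [Finite ι] [QuasiSeparatedSpace X]
    [Module.FaithfullyFlat A B]
    (H : IsPullback g fZ fX (Spec.map (CommRingCat.ofHom (algebraMap A B))))
    (hU : ∀ i, IsAffineOpen (U i))
    (h : cechZ1 (restrictBase A fZ) (preimageFamily g U) ≤
      cechB1 (restrictBase A fZ) (preimageFamily g U)) :
    cechZ1 fX U ≤ cechB1 fX U := by
  have hex : Function.Exact (cechD0 fX U) (cechD1 fX U) :=
    Module.FaithfullyFlat.lTensor_reflects_exact A B (cechD0 fX U) (cechD1 fX U)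
      (lTensor_cechD0_cechD1_exact_of_preimageFamily fX fZ g U H hU h)
  intro c hc
  rw [mem_cechB1_iff]
  exact (hex c).mp ((mem_cechZ1_iff _ _ _).mp hc)

/-- The same with the classes: **`Ȟ¹(g⁻¹𝒰, 𝒪_Z) = 0 ⇒ Ȟ¹(𝒰, 𝒪_X) = 0`** for `A → B` faithfully
flat (`Ȟ¹(g⁻¹𝒰, 𝒪_Z)` for the `A`-structure `Z → Spec B → Spec A`; as a group it is the same for
the `B`-structure). [cite: StacksProject, Tag 02KH (Cohomology of Schemes, Lemma 30.5.2: flat base change)] -/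
theorem subsingleton_cechH1_of_preimageFamily_of_faithfullyFlat [Finite ι] [QuasiSeparatedSpace X]
    [Module.FaithfullyFlat A B]
    (H : IsPullback g fZ fX (Spec.map (CommRingCat.ofHom (algebraMap A B))))
    (hU : ∀ i, IsAffineOpen (U i))
    (h : Subsingleton (CechH1 (restrictBase A fZ) (preimageFamily g U))) :
    Subsingleton (CechH1 fX U) := by
  rw [Submodule.Quotient.subsingleton_iff, eq_top_iff] at h ⊢
  rintro z -
  exact cechZ1_le_cechB1_of_preimageFamily_of_faithfullyFlat fX fZ g U H hU
    (fun c hc => h (x := ⟨c, hc⟩) trivial) z.2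

/-- **`Ȟ¹(g⁻¹𝒰, 𝒪_Z) = 0 ↔ Ȟ¹(𝒰, 𝒪_X) = 0`** for `A → B` faithfully flat (`X` quasi-separated,
`𝒰` finite with affine members): descent (this file) and flat ascent
(`subsingleton_cechH1_preimageFamily_of_flat`).
[cite: StacksProject, Tag 02KH (Cohomology of Schemes, Lemma 30.5.2: flat base change)] -/
theorem subsingleton_cechH1_preimageFamily_iff_of_faithfullyFlat [Finite ι] [QuasiSeparatedSpace X]
    [Module.FaithfullyFlat A B]
    (H : IsPullback g fZ fX (Spec.map (CommRingCat.ofHom (algebraMap A B))))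
    (hU : ∀ i, IsAffineOpen (U i)) :
    Subsingleton (CechH1 (restrictBase A fZ) (preimageFamily g U)) ↔ Subsingleton (CechH1 fX U) :=
  ⟨subsingleton_cechH1_of_preimageFamily_of_faithfullyFlat fX fZ g U H hU,
    subsingleton_cechH1_preimageFamily_of_flat fX fZ g U H hU⟩

/-! ## All finite affine covers -/

/-- **`H¹ = 0` descends along faithfully flat base change**: for the cartesian square
`Z = X ×_{Spec A} Spec B` with `A → B` faithfully flat and `X` quasi-separated, if
`Ȟ¹(𝒱, 𝒪_Z) = 0` for every finite affine open cover `𝒱` of `Z` (`Ȟ¹` for the `B`-structure `f_Z`)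
then `Ȟ¹(𝒰, 𝒪_X) = 0` for every finite affine open cover `𝒰` of `X` (pull `𝒰` back — its members
stay affine since `g`, a base change of the affine `Spec B → Spec A`, is an affine morphism — and
apply `subsingleton_cechH1_of_preimageFamily_of_faithfullyFlat`).
[cite: StacksProject, Tag 02KH (Cohomology of Schemes, Lemma 30.5.2: flat base change)] -/
theorem subsingleton_cechH1_of_isPullback_of_faithfullyFlat [QuasiSeparatedSpace X]
    [Module.FaithfullyFlat A B]
    (H : IsPullback g fZ fX (Spec.map (CommRingCat.ofHom (algebraMap A B))))
    (hZ : ∀ (κ : Type v) [Finite κ] (V : κ → Z.Opens),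
      (∀ i, IsAffineOpen (V i)) → ⨆ i, V i = ⊤ → Subsingleton (CechH1 fZ V))
    [Finite ι] (hU : ∀ i, IsAffineOpen (U i)) (hUcov : ⨆ i, U i = ⊤) :
    Subsingleton (CechH1 fX U) := by
  -- `g` is affine (base change of `Spec B → Spec A`), so `g⁻¹U_i` is affine
  haveI : IsAffineHom g :=
    MorphismProperty.of_isPullback (P := @IsAffineHom) H.flip inferInstance
  have hU' : ∀ i, IsAffineOpen (preimageFamily g U i) := fun i => (hU i).preimage g
  have hU'cov : ⨆ i, preimageFamily g U i = ⊤ := g.iSup_preimage_eq_top hUcov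
  -- `Ȟ¹(g⁻¹𝒰, 𝒪_Z) = 0`; the base ring (`B` or `A`) does not matter for this
  have h0 : Subsingleton (CechH1 (restrictBase A fZ) (preimageFamily g U)) := hZ ι _ hU' hU'cov
  exact subsingleton_cechH1_of_preimageFamily_of_faithfullyFlat fX fZ g U H hU h0

end Literature.AlgebraicGeometry.Morphisms

end
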